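import Mathlib
import Summits.KontsevichZagierPeriods.Zeta5Search.Elimination.PairEnvelope
import Summits.KontsevichZagierPeriods.Zeta5Search.Elimination.PairMargin
import HarnessLib

/-!
# ζ(5) search — class `elim`: the DETERMINANT ENVELOPE for `k`-family elimination (cell `pub-zeta5`, fam-elim, E-L9)

HONEST FRAMING: systematic search; no irrationality claim unless certified.

OUR work (Summit side; `families/elim/FAMILY.md` §5, Proposition P1ₖ — the `k`-family generalisation of the
pair envelope P1 = `PairEnvelope.lean` + `PairMargin.lean`).  The brief of the class asks for PAIRS AND TRIPLES of
families combined by exact (determinant) elimination.  A triple is meaningful for rank-4 forms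
`r_X = u_X ξ + w_{1,X} θ₁ + w_{2,X} θ₂ - v_X` (e.g. `ξ = ζ(5)`, `θ = (ζ(3), ζ(7))`), and in general `k` families
`X₀, …, X_{k-1}` of rank-`(k+1)` forms are combined into the `θ`-free ELIMINANT

  `ℓ_n = det M_n`,   `M_n` = the `k × k` matrix with row `0` = the forms `(r_X(n))_X` and row `p ≥ 1` = the
  coefficients `(w_{p,X}(n))_X` of the parasitic period `θ_p`.

This file proves, with 0 `sorry` and nothing about ζ-values or any specific family:

* `det_eliminates` — the algebra: `det M = ξ · det M[0 := u] + det M[0 := v]`; every `θ_p` drops out (a row of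
  `M[0 := w_p]` is repeated);
* `det_rateLE` — P1ₖ(a): `|ℓ_n| ≤ e^{(A+ε) n}` eventually, `A = max_σ Σ_i a(σ i, i)` over the `k!` transversals of
  the entry-rate matrix `a` (`a(0,X) = -c_X` decay of the forms, `a(p,X) = b_{p,X}` growth of the coefficients);
* `det_rateGE` — P1ₖ(b): if ONE transversal `σ₀` strictly dominates all others and its factors have exact rates,
  then `|ℓ_n| ≥ e^{(Σ_i a(σ₀ i, i) - ε) n}`: NO cancellation is possible between unrelated families;
* `det_margin_le_mean`, `mean_le_of_forall_le` — P1ₖ(d), the bookkeeping corollary in CRITERIA units: with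
  product-rule denominators (multiplier rate `≥ max_σ Σ_i d(σ i, i)`, `d(0,X) = δ_{v,X}`, `d(p,X) = δ_{p,X}`) the
  C1-margin `μ₁(ℓ) = -Σ_i a(σ₀ i,i) - δ` of a `k`-family cross eliminant is AT MOST THE MEAN over the `k` partners of
  the column exponents `FZ_k(X) = c_X - δ_{v,X} - Σ_p (b_{p,X} + δ_{p,X})` (the exponent of `X`'s OWN
  `k`-consecutive-index elimination under the product rule), hence at most the best one.  The proof averages over the
  `k` CYCLIC transversals, which tile the matrix (`sum_cyclic_transversals`);
* `det_no_go` — P1ₖ packaged (T4): mean `< 0` ⇒ the cleared eliminant `K_n ℓ_n` has a positive lower rate and does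
  not tend to `0`; no `k`-tuple of families with negative exponents yields a certificate by cross elimination.
  For `k = 2` this is exactly `pair_no_go` (E-L6); the closing `example` checks that the `2 × 2` determinant is the
  eliminant `w^G r^F - w^F r^G` of `PairEnvelope.lean`.

Reading for the census (`FAMILY.md` §3, §11): every family on the cell's census has a negative own exponent, so
every pair AND every triple row of §11 is closed by THEOREM, not by measurement.  Pure bookkeeping over the
`RateLE` / `RateGE` predicates of E-L1.
-/

noncomputable section

open Filter Topology Finset

namespace Summit.KontsevichZagierPeriods.Zeta5Search.Elimination

/-! ### 0. Algebra: a `k × k` determinant of forms eliminates every parasitic period -/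

/-- **The eliminant is `θ`-free.**  If row `i₀` of `M` is the row of forms
`r_i = ξ u_i + Σ_{p ≠ i₀} θ_p M p i + v_i` whose parasitic coefficient rows ARE the other rows of `M`, then
`det M = ξ · det M[i₀ := u] + det M[i₀ := v]`: all the `θ_p` are eliminated (repeated rows). -/
theorem det_eliminates {ι : Type*} [Fintype ι] [DecidableEq ι] (M : Matrix ι ι ℝ) (i₀ : ι)
    (ξ : ℝ) (u v θ : ι → ℝ)
    (hrow : M i₀ = fun i => ξ * u i + (∑ p ∈ univ.erase i₀, θ p * M p i) + v i) :
    M.det = ξ * (M.updateRow i₀ u).det + (M.updateRow i₀ v).det := by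
  have hfun : ξ • u + (∑ p ∈ univ.erase i₀, θ p • M p) + v = M i₀ := by
    rw [hrow]
    funext i
    simp [Finset.sum_apply, smul_eq_mul]
  have hM : M.updateRow i₀ (ξ • u + (∑ p ∈ univ.erase i₀, θ p • M p) + v) = M := by
    rw [hfun, Matrix.updateRow_eq_self]
  have hpar : (M.updateRow i₀ (∑ p ∈ univ.erase i₀, θ p • M p)).det = 0 := by
    have h := Matrix.det_updateRow_sum_aux M (univ.erase i₀) (Finset.univ.notMem_erase i₀) θ 0
    simpa using h
  calc M.det = (M.updateRow i₀ (ξ • u + (∑ p ∈ univ.erase i₀, θ p • M p) + v)).det := by rw [hM]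
    _ = ξ * (M.updateRow i₀ u).det + (M.updateRow i₀ v).det := by
        rw [Matrix.det_updateRow_add, Matrix.det_updateRow_add, Matrix.det_updateRow_smul, hpar, add_zero]

/-! ### 1. Finite sums and products of exponential rates -/

/-- The zero sequence has every upper rate. -/
theorem rateLE_zero (a : ℝ) : RateLE (fun _ => (0 : ℝ)) a := by
  intro ε hε
  exact Filter.Eventually.of_forall fun n => by simp [Real.exp_nonneg]

/-- The constant sequence `1` has upper rate `0`. -/
theorem rateLE_one : RateLE (fun _ => (1 : ℝ)) 0 := by
  intro ε hε
  refine Filter.Eventually.of_forall fun n => ?_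
  have h : (0 : ℝ) ≤ (0 + ε) * n := by positivity
  simpa using Real.one_le_exp h

/-- The constant sequence `1` has lower rate `0`. -/
theorem rateGE_one : RateGE (fun _ => (1 : ℝ)) 0 := by
  intro ε hε
  refine Filter.Eventually.of_forall fun n => ?_
  have hn : (0 : ℝ) ≤ n := Nat.cast_nonneg n
  have h : (0 - ε) * (n : ℝ) ≤ 0 := by nlinarith
  simpa using Real.exp_le_one_iff.mpr h

/-- Sum rule for upper rates: the rate of a sum is at most the larger rate. -/
theorem rateLE_add {x y : ℕ → ℝ} {a b : ℝ} (hx : RateLE x a) (hy : RateLE y b) :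
    RateLE (fun n => x n + y n) (max a b) := by
  have hy' : RateLE (fun n => -y n) b := by
    intro ε hε
    simpa [abs_neg] using hy ε hε
  simpa [sub_neg_eq_add] using rateLE_sub hx hy'

/-- NO CANCELLATION under a rate gap, additive form: `x` of exact lower rate `a` plus `y` of upper rate `b < a`
still has lower rate `a`. -/
theorem rateGE_add_of_gap {x y : ℕ → ℝ} {a b : ℝ} (hx : RateGE x a) (hy : RateLE y b) (hab : b < a) :
    RateGE (fun n => x n + y n) a := by
  have hy' : RateLE (fun n => -y n) b := by
    intro ε hε
    simpa [abs_neg] using hy ε hε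
  simpa [sub_neg_eq_add] using rateGE_sub_of_gap hx hy' hab

/-- Finite-sum rule: a finite sum of sequences of upper rate `≤ A` has upper rate `A`. -/
theorem rateLE_sum {κ : Type*} (s : Finset κ) {f : κ → ℕ → ℝ} {A : ℝ}
    (h : ∀ i ∈ s, RateLE (f i) A) : RateLE (fun n => ∑ i ∈ s, f i n) A := by
  classical
  induction s using Finset.induction_on with
  | empty => simpa using rateLE_zero A
  | insert i s hi ih =>
      have h1 : RateLE (f i) A := h i (Finset.mem_insert_self i s)
      have h2 : RateLE (fun n => ∑ j ∈ s, f j n) A := ih fun j hj => h j (Finset.mem_insert_of_mem hj)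
      simpa [Finset.sum_insert hi, max_self] using rateLE_add h1 h2

/-- Finite-product rule for upper rates: exponents add. -/
theorem rateLE_prod {κ : Type*} (s : Finset κ) {f : κ → ℕ → ℝ} {a : κ → ℝ}
    (h : ∀ i ∈ s, RateLE (f i) (a i)) : RateLE (fun n => ∏ i ∈ s, f i n) (∑ i ∈ s, a i) := by
  classical
  induction s using Finset.induction_on with
  | empty => simpa using rateLE_one
  | insert i s hi ih =>
      have h1 : RateLE (f i) (a i) := h i (Finset.mem_insert_self i s)
      have h2 : RateLE (fun n => ∏ j ∈ s, f j n) (∑ j ∈ s, a j) :=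
        ih fun j hj => h j (Finset.mem_insert_of_mem hj)
      simpa [Finset.prod_insert hi, Finset.sum_insert hi] using rateLE_mul h1 h2

/-- Finite-product rule for lower rates: exponents add. -/
theorem rateGE_prod {κ : Type*} (s : Finset κ) {f : κ → ℕ → ℝ} {a : κ → ℝ}
    (h : ∀ i ∈ s, RateGE (f i) (a i)) : RateGE (fun n => ∏ i ∈ s, f i n) (∑ i ∈ s, a i) := by
  classical
  induction s using Finset.induction_on with
  | empty => simpa using rateGE_one
  | insert i s hi ih =>
      have h1 : RateGE (f i) (a i) := h i (Finset.mem_insert_self i s)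
      have h2 : RateGE (fun n => ∏ j ∈ s, f j n) (∑ j ∈ s, a j) :=
        ih fun j hj => h j (Finset.mem_insert_of_mem hj)
      simpa [Finset.prod_insert hi, Finset.sum_insert hi] using rateGE_mul h1 h2

/-! ### 2. Rates of a determinant (Leibniz expansion) -/

/-- `|sign σ| = 1` as a real number. -/
theorem abs_sign_cast {ι : Type*} [Fintype ι] [DecidableEq ι] (σ : Equiv.Perm ι) :
    |((Equiv.Perm.sign σ : ℤ) : ℝ)| = 1 := by
  rcases Int.units_eq_one_or (Equiv.Perm.sign σ) with h | h <;> simp [h]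

/-- Upper rate of one Leibniz term `sign σ · Π_i M (σ i) i`: the transversal sum of the entry rates. -/
theorem leibnizTerm_rateLE {ι : Type*} [Fintype ι] [DecidableEq ι] {M : ι → ι → ℕ → ℝ} {a : ι → ι → ℝ}
    (h : ∀ i j, RateLE (M i j) (a i j)) (σ : Equiv.Perm ι) :
    RateLE (fun n => ((Equiv.Perm.sign σ : ℤ) : ℝ) * ∏ i, M (σ i) i n) (∑ i, a (σ i) i) := by
  have hp : RateLE (fun n => ∏ i, M (σ i) i n) (∑ i, a (σ i) i) :=
    rateLE_prod Finset.univ fun i _ => h (σ i) i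
  intro ε hε
  filter_upwards [hp ε hε] with n hn
  rw [abs_mul, abs_sign_cast, one_mul]
  exact hn

/-- Lower rate of one Leibniz term whose factors have exact lower rates. -/
theorem leibnizTerm_rateGE {ι : Type*} [Fintype ι] [DecidableEq ι] {M : ι → ι → ℕ → ℝ} {a : ι → ι → ℝ}
    (σ : Equiv.Perm ι) (hdom : ∀ i, RateGE (M (σ i) i) (a (σ i) i)) :
    RateGE (fun n => ((Equiv.Perm.sign σ : ℤ) : ℝ) * ∏ i, M (σ i) i n) (∑ i, a (σ i) i) := by
  have hp : RateGE (fun n => ∏ i, M (σ i) i n) (∑ i, a (σ i) i) :=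
    rateGE_prod Finset.univ fun i _ => hdom i
  intro ε hε
  filter_upwards [hp ε hε] with n hn
  rw [abs_mul, abs_sign_cast, one_mul]
  exact hn

/-- The determinant of the matrix-valued sequence `n ↦ (M i j n)_{i,j}` is its Leibniz sum. -/
theorem det_seq_eq {ι : Type*} [Fintype ι] [DecidableEq ι] (M : ι → ι → ℕ → ℝ) (n : ℕ) :
    (Matrix.of fun i j => M i j n).det
      = ∑ σ : Equiv.Perm ι, ((Equiv.Perm.sign σ : ℤ) : ℝ) * ∏ i, M (σ i) i n := by
  simp only [Matrix.det_apply', Matrix.of_apply]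

/-- **P1ₖ(a): the determinant envelope, upper half.**  If every entry sequence `M i j` has upper rate `a i j`,
the determinant has upper rate `A` for any `A` bounding all `k!` transversal sums `Σ_i a (σ i) i`. -/
theorem det_rateLE {ι : Type*} [Fintype ι] [DecidableEq ι] {M : ι → ι → ℕ → ℝ} {a : ι → ι → ℝ} {A : ℝ}
    (h : ∀ i j, RateLE (M i j) (a i j)) (hA : ∀ σ : Equiv.Perm ι, ∑ i, a (σ i) i ≤ A) :
    RateLE (fun n => (Matrix.of fun i j => M i j n).det) A := by
  have hsum : RateLE (fun n => ∑ σ : Equiv.Perm ι, ((Equiv.Perm.sign σ : ℤ) : ℝ) * ∏ i, M (σ i) i n) A :=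
    rateLE_sum Finset.univ fun σ _ => (leibnizTerm_rateLE h σ).mono (hA σ)
  have heq : (fun n => (Matrix.of fun i j => M i j n).det)
      = fun n => ∑ σ : Equiv.Perm ι, ((Equiv.Perm.sign σ : ℤ) : ℝ) * ∏ i, M (σ i) i n := by
    funext n
    exact det_seq_eq M n
  rw [heq]
  exact hsum

/-- **P1ₖ(b): the determinant envelope, lower half — no cancellation between unrelated families.**  If the
transversal `σ₀` has factors with EXACT lower rates and its rate sum strictly exceeds a common bound `T₂` of all the
other transversal sums, then the determinant has lower rate `Σ_i a (σ₀ i) i`. -/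
theorem det_rateGE {ι : Type*} [Fintype ι] [DecidableEq ι] {M : ι → ι → ℕ → ℝ} {a : ι → ι → ℝ}
    (σ₀ : Equiv.Perm ι) {T₂ : ℝ}
    (h : ∀ i j, RateLE (M i j) (a i j)) (hdom : ∀ i, RateGE (M (σ₀ i) i) (a (σ₀ i) i))
    (hgap : ∀ σ : Equiv.Perm ι, σ ≠ σ₀ → ∑ i, a (σ i) i ≤ T₂) (hT : T₂ < ∑ i, a (σ₀ i) i) :
    RateGE (fun n => (Matrix.of fun i j => M i j n).det) (∑ i, a (σ₀ i) i) := by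
  have hmain := leibnizTerm_rateGE (M := M) σ₀ hdom
  have hrest : RateLE
      (fun n => ∑ σ ∈ univ.erase σ₀, ((Equiv.Perm.sign σ : ℤ) : ℝ) * ∏ i, M (σ i) i n) T₂ :=
    rateLE_sum (univ.erase σ₀) fun σ hσ =>
      (leibnizTerm_rateLE h σ).mono (hgap σ (Finset.ne_of_mem_erase hσ))
  have hadd := rateGE_add_of_gap hmain hrest hT
  have heq : (fun n => (Matrix.of fun i j => M i j n).det) = fun n =>
      ((Equiv.Perm.sign σ₀ : ℤ) : ℝ) * ∏ i, M (σ₀ i) i n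
        + ∑ σ ∈ univ.erase σ₀, ((Equiv.Perm.sign σ : ℤ) : ℝ) * ∏ i, M (σ i) i n := by
    funext n
    rw [det_seq_eq M n, ← Finset.add_sum_erase Finset.univ _ (Finset.mem_univ σ₀)]
  rw [heq]
  exact hadd

/-! ### 3. The margin bookkeeping: never better than the MEAN of the partners (cyclic transversals) -/

/-- The `k` cyclic transversals `i ↦ (i + t, i)` tile the `k × k` matrix: summing an entry function over them is
summing it over all entries (column by column). -/
theorem sum_cyclic_transversals {k : ℕ} [NeZero k] (f : Fin k → Fin k → ℝ) :
    ∑ t : Fin k, ∑ i : Fin k, f (i + t) i = ∑ i : Fin k, ∑ j : Fin k, f j i := by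
  rw [Finset.sum_comm]
  refine Finset.sum_congr rfl fun i _ => ?_
  exact Fintype.sum_equiv (Equiv.addLeft i) _ _ (fun t => rfl)

/-- The mean of `k` numbers all `≤ B` is `≤ B` ("never better than the BEST partner" follows from
"never better than the mean"). -/
theorem mean_le_of_forall_le {k : ℕ} [NeZero k] (g : Fin k → ℝ) (B : ℝ) (hB : ∀ i, g i ≤ B) :
    (∑ i, g i) / k ≤ B := by
  have hk : (0 : ℝ) < k := by exact_mod_cast Nat.pos_of_ne_zero (NeZero.ne k)
  rw [div_le_iff₀ hk]
  calc ∑ i, g i ≤ ∑ _i : Fin k, B := Finset.sum_le_sum fun i _ => hB i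
    _ = B * k := by
        rw [Finset.sum_const, Finset.card_univ, Fintype.card_fin, nsmul_eq_mul]
        ring

/-- **P1ₖ(d): a `k`-family determinant elimination is never better than the MEAN of the partners' own exponents.**
`a` = entry upper rates (`a (0,X) = -c_X`, `a (p,X) = b_{p,X}`), `d` = entry denominator rates, `σ₀` = the dominant
transversal (so the eliminant decays at rate `-Σ_i a(σ₀ i, i)` at best), `δ` = any multiplier rate clearing all
`k!` Leibniz products (product rule: `δ ≥ Σ_i d(σ i, i)` for every `σ`).  Then the C1-margin satisfies
`-Σ_i a(σ₀ i,i) - δ ≤ (1/k) Σ_X FZ_k(X)` with the COLUMN exponents `FZ_k(X) = Σ_p (-a(p,X) - d(p,X))`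
`= c_X - δ_{v,X} - Σ_{p ≥ 1} (b_{p,X} + δ_{p,X})`.  Proof: average the trivial bounds over the `k` cyclic transversals. -/
theorem det_margin_le_mean {k : ℕ} [NeZero k] (a d : Fin k → Fin k → ℝ) (σ₀ : Equiv.Perm (Fin k)) (δ : ℝ)
    (hmax : ∀ σ : Equiv.Perm (Fin k), ∑ i, a (σ i) i ≤ ∑ i, a (σ₀ i) i)
    (hδ : ∀ σ : Equiv.Perm (Fin k), ∑ i, d (σ i) i ≤ δ) :
    -(∑ i, a (σ₀ i) i) - δ ≤ (∑ i : Fin k, ∑ j : Fin k, (-a j i - d j i)) / k := by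
  have hk : (0 : ℝ) < k := by exact_mod_cast Nat.pos_of_ne_zero (NeZero.ne k)
  rw [le_div_iff₀ hk]
  have hshift : ∀ t : Fin k,
      -(∑ i, a (σ₀ i) i) - δ ≤ ∑ i : Fin k, (-a (i + t) i - d (i + t) i) := by
    intro t
    have h1 := hmax (Equiv.addRight t)
    have h2 := hδ (Equiv.addRight t)
    simp only [Equiv.coe_addRight] at h1 h2
    have h3 : ∑ i : Fin k, (-a (i + t) i - d (i + t) i) = -(∑ i, a (i + t) i) - ∑ i, d (i + t) i := by
      rw [Finset.sum_sub_distrib, Finset.sum_neg_distrib]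
    linarith
  calc (-(∑ i, a (σ₀ i) i) - δ) * k = ∑ _t : Fin k, (-(∑ i, a (σ₀ i) i) - δ) := by
          rw [Finset.sum_const, Finset.card_univ, Fintype.card_fin, nsmul_eq_mul]
          ring
    _ ≤ ∑ t : Fin k, ∑ i : Fin k, (-a (i + t) i - d (i + t) i) := Finset.sum_le_sum fun t _ => hshift t
    _ = ∑ i : Fin k, ∑ j : Fin k, (-a j i - d j i) := sum_cyclic_transversals (fun j i => -a j i - d j i)

/-! ### 4. The no-go of the class for `k` families, packaged (P1ₖ of `FAMILY.md`; T4) -/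

/-- **DETERMINANT NO-GO (P1ₖ).**  `k` families `X₀, …, X_{k-1}` with entry sequences `M p X` (row `0` = the forms,
rows `p ≥ 1` = the parasitic coefficients) of upper rates `a p X`, a dominant transversal `σ₀` with exact factor rates
and a strict gap `T₂ < Σ_i a(σ₀ i,i)` above all other transversal sums, cleared by a multiplier `K` of rate `δ` at least
the product-rule rate of every transversal of the denominator matrix `d`.  If the MEAN of the `k` column exponents
`FZ_k(X) = Σ_p (-a(p,X) - d(p,X))` is negative, then the cleared eliminant `K_n det M_n` has the positive lower rate
`δ + Σ_i a(σ₀ i,i)` and does not tend to `0`: the `k`-tuple gives no irrationality certificate for `ξ`.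
For `k = 2` this is `pair_no_go`. -/
theorem det_no_go {k : ℕ} [NeZero k] {M : Fin k → Fin k → ℕ → ℝ} {K : ℕ → ℝ} {a d : Fin k → Fin k → ℝ}
    (σ₀ : Equiv.Perm (Fin k)) {T₂ δ : ℝ}
    (h : ∀ i j, RateLE (M i j) (a i j)) (hdom : ∀ i, RateGE (M (σ₀ i) i) (a (σ₀ i) i))
    (hgap : ∀ σ : Equiv.Perm (Fin k), σ ≠ σ₀ → ∑ i, a (σ i) i ≤ T₂) (hT : T₂ < ∑ i, a (σ₀ i) i)
    (hK : RateGE K δ) (hδ : ∀ σ : Equiv.Perm (Fin k), ∑ i, d (σ i) i ≤ δ)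
    (hmean : (∑ i : Fin k, ∑ j : Fin k, (-a j i - d j i)) / k < 0) :
    RateGE (fun n => K n * (Matrix.of fun i j => M i j n).det) (δ + ∑ i, a (σ₀ i) i) ∧
      0 < δ + ∑ i, a (σ₀ i) i ∧
      ¬ Tendsto (fun n => K n * (Matrix.of fun i j => M i j n).det) atTop (𝓝 0) := by
  have hdet := det_rateGE σ₀ h hdom hgap hT
  have hrate : RateGE (fun n => K n * (Matrix.of fun i j => M i j n).det) (δ + ∑ i, a (σ₀ i) i) :=
    rateGE_mul hK hdet
  have hmax : ∀ σ : Equiv.Perm (Fin k), ∑ i, a (σ i) i ≤ ∑ i, a (σ₀ i) i := by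
    intro σ
    by_cases hσ : σ = σ₀
    · rw [hσ]
    · exact (hgap σ hσ).trans hT.le
  have hm := det_margin_le_mean a d σ₀ δ hmax hδ
  have hpos : 0 < δ + ∑ i, a (σ₀ i) i := by linarith
  exact ⟨hrate, hpos, not_tendsto_zero_of_rateGE_pos hrate hpos⟩

/-- Consistency with E-L1: for `k = 2` the determinant eliminant IS the pair eliminant `w^G r^F - w^F r^G`
(row `0` = forms `(r^F, r^G)`, row `1` = ζ(3)-coefficients `(w^F, w^G)`). -/
example (rF rG wF wG : ℝ) : (Matrix.of ![![rF, rG], ![wF, wG]]).det = wG * rF - wF * rG := by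
  rw [Matrix.det_fin_two_of]
  ring

end Summit.KontsevichZagierPeriods.Zeta5Search.Elimination
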